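import Summits.HodgeConjecture.HodgeConjecture.Theorems.F0P3cStCharTSUpMeas      -- ★ p851766 (g21) `measurable_up_of_upDef_of_measurable`, `upSpec_of_upTransfer`
import Literature.NumberTheory.Rogawski1990.Ch12Sec5UpSpecLB                      -- `Ch12Sec5.EllipticData.UpSpecLB` (ROAD «UP-TR», desk D1′ (j1))
import HarnessLib

/-!
# F0 · P3c · line LH6 «StCharTS» — ROAD «UP-TR»: `UpSpecLB` ⟸ UP-TRANSFER-LB (the junction plug twin of ★ `upSpec_of_upTransfer`)

Cell `pub/hodgecm-mathlib`, crux H413 = `stmt-HodgeConjecture-24833` (lane `--supports … --as helper`, count-neutral); seat F0P3-p02 (g23), ROAD «UP-TR» holder.  THEOREMS ONLY.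
WHAT.  `upSpecLB_of_upTransferLB`: at the (UP-DEF) datum, the LOCALLY-BOUNDED transfer clause (the conclusion of the road's terminal head (A1′) `UpTransferLB`: the p. 183 display
for the `α` with `D_H · α` locally bounded on `𝔇.regH`) plus ★ UpSpec (1)(2) (`measurable_up_of_upDef_of_measurable`, `isClassFunOn_up_of_upDef`) give ★ `Ch12Sec5.EllipticData.UpSpecLB 𝔇`
— the package conjunct of the UP-TR rider (junction v8), JUNCTION PLUG `hUpSpecLB := upSpecLB_of_upTransferLB … hUp hUpTrLB`, binders = those of ★ `upSpec_of_upTransfer` with `hUpTr`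
replaced by `hUpTrLB` (one extra antecedent).  HONEST LABEL: count-neutral; `UpSpecLB` is weaker than print's `UpSpec` clause 3 (general `α`), which is NOT claimed in house; HC_CM is
proved only modulo the 7 printed citations (2 remaining: hLiu418 = `stmt-HodgeConjecture-24832`, h413 = `stmt-HodgeConjecture-24833`) until rung 0 closes.

## References
* [Rogawski1990] J. D. Rogawski, *Automorphic Representations of Unitary Groups in Three Variables*, Ann. of Math. Stud. 123 (1990), §12.5 p. 183.
-/

set_option autoImplicit false
-- the mandated namespace has the single-problem summit's repeated segment (`HodgeConjecture.HodgeConjecture`)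
set_option linter.dupNamespace false

noncomputable section

open MeasureTheory NumberField IsDedekindDomain
open scoped Matrix MatrixGroups Classical
open Literature.NumberTheory.Rogawski1990 Literature.NumberTheory.Automorphic Literature.NumberTheory.Automorphic.UnitaryGroup
open Literature.NumberTheory.GaloisRepresentations

namespace Summit.HodgeConjecture.HodgeConjecture.Cruxes.H413.F0P3cStCharTSUpTrSpecLB

variable (L : Type) [Field L] [NumberField L] [IsCMField L] (v : HeightOneSpectrum (𝓞 ↥(maximalRealSubfield L)))

/-- **`UpSpecLB` FROM ITS LOCALLY-BOUNDED TRANSFER CLAUSE** at the (UP-DEF) datum: clauses (1)(2) by ★ UpMeas ∕ UpClass, clause (3)-LB = the hypothesis `hUpTrLB` (the ROAD «UP-TR»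
terminal head).  JUNCTION PLUG: `hUpSpecLB := upSpecLB_of_upTransferLB … hUp hUpTrLB`. [cite: Rogawski1990, §12.5 p. 183] -/
theorem upSpecLB_of_upTransferLB (μ : HeckeCharacter L)
    (hns : ∀ w : UnitaryGroup.PlacesOver L v, IsCMField.complexConj L • w.1 = w.1)
    [MeasurableSpace (Gqs L v)] [BorelSpace (Gqs L v)] [∀ γ : Gqs L v, MeasurableSpace (Gqs L v ⧸ Subgroup.centralizer ({γ} : Set (Gqs L v)))]
    [MeasurableSpace (Gqs L v ⧸ Subgroup.center (Gqs L v))]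
    [MeasurableSpace ((UnitaryGroup.cmDatum L 2 (Matrix.of fun i j : Fin 2 => if i.val + j.val + 1 = 2 then (1 : L) else 0)).Local v ×
      (UnitaryGroup.cmDatum L 1 (Matrix.of fun i j : Fin 1 => if i.val + j.val + 1 = 1 then (1 : L) else 0)).Local v)]
    [BorelSpace ((UnitaryGroup.cmDatum L 2 (Matrix.of fun i j : Fin 2 => if i.val + j.val + 1 = 2 then (1 : L) else 0)).Local v ×
      (UnitaryGroup.cmDatum L 1 (Matrix.of fun i j : Fin 1 => if i.val + j.val + 1 = 1 then (1 : L) else 0)).Local v)]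
    (𝔇 : Ch12Sec5.EllipticData (Gqs L v)
      ((UnitaryGroup.cmDatum L 2 (Matrix.of fun i j : Fin 2 => if i.val + j.val + 1 = 2 then (1 : L) else 0)).Local v ×
        (UnitaryGroup.cmDatum L 1 (Matrix.of fun i j : Fin 1 => if i.val + j.val + 1 = 1 then (1 : L) else 0)).Local v))
    (hStH : ∀ a b, 𝔇.stConjH a b ↔ IsLocalStablyConjH L v a b)
    (hRegH : ∀ a, IsLocalGRegular L v a → a ∈ 𝔇.regH)
    (hDHst : ∀ a b, IsLocalGRegular L v a → IsLocalStablyConjH L v a b → 𝔇.DH b = 𝔇.DH a)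
    (hDGm : Measurable 𝔇.DG) (hDHm : Measurable 𝔇.DH)
    (hDGcl : ∀ x y : Gqs L v, 𝔇.DG (y * x * y⁻¹) = 𝔇.DG x)
    (hUp : ∀ (α : ((UnitaryGroup.cmDatum L 2 (Matrix.of fun i j : Fin 2 => if i.val + j.val + 1 = 2 then (1 : L) else 0)).Local v ×
        (UnitaryGroup.cmDatum L 1 (Matrix.of fun i j : Fin 1 => if i.val + j.val + 1 = 1 then (1 : L) else 0)).Local v) → ℂ) (x : Gqs L v),
      𝔇.up α x =
        if IsRegularElt (x.val : GL (Fin 3) (UnitaryGroup.LocalRing L v)) then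
          ((𝔇.DG x : ℂ))⁻¹ *
            ∑ᶠ q : Quot (IsLocalStablyConjH L v),
              (if IsLocalGRegular L v q.out ∧ IsLocalNormPair L (qsForm L) v q.out x then
                finTau L v q.out μ * (𝔇.DH q.out : ℂ) * ((finKappaAt L v (qsForm L) q.out x : ℤ) : ℂ) * α q.out
              else 0)
        else 0)
    (hUpTrLB : ∀ α : ((UnitaryGroup.cmDatum L 2 (Matrix.of fun i j : Fin 2 => if i.val + j.val + 1 = 2 then (1 : L) else 0)).Local v ×
        (UnitaryGroup.cmDatum L 1 (Matrix.of fun i j : Fin 1 => if i.val + j.val + 1 = 1 then (1 : L) else 0)).Local v) → ℂ,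
      Measurable α → Ch12Sec5.IsStableClassFunOn 𝔇.stConjH 𝔇.regH α →
        (∀ C : Set (((UnitaryGroup.cmDatum L 2 (Matrix.of fun i j : Fin 2 => if i.val + j.val + 1 = 2 then (1 : L) else 0)).Local v ×
            (UnitaryGroup.cmDatum L 1 (Matrix.of fun i j : Fin 1 => if i.val + j.val + 1 = 1 then (1 : L) else 0)).Local v)),
          IsCompact C → ∃ B : ℝ, ∀ s ∈ C, s ∈ 𝔇.regH → ‖(𝔇.DH s : ℂ) * α s‖ ≤ B) →
        ∀ f ∈ SchwartzBruhat (Gqs L v), ∀ fH : ((UnitaryGroup.cmDatum L 2 (Matrix.of fun i j : Fin 2 => if i.val + j.val + 1 = 2 then (1 : L) else 0)).Local v ×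
            (UnitaryGroup.cmDatum L 1 (Matrix.of fun i j : Fin 1 => if i.val + j.val + 1 = 1 then (1 : L) else 0)).Local v) → ℂ, 𝔇.IsTransfer f fH →
          Integrable (fun g => f g * 𝔇.up α g) 𝔇.μG → Integrable (fun h => fH h * α h) 𝔇.μH →
          ∫ g, f g * 𝔇.up α g ∂𝔇.μG = ∫ h, fH h * α h ∂𝔇.μH) :
    𝔇.UpSpecLB := fun α hαm hα =>
  ⟨F0P3cStCharTSUpMeas.measurable_up_of_upDef_of_measurable L v μ hns 𝔇 hStH hRegH hDHst hDGm hDHm hUp α hα hαm,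
    F0P3cStCharTSUpClass.isClassFunOn_up_of_upDef L v μ 𝔇 hUp hDGcl α 𝔇.regG, hUpTrLB α hαm hα⟩

end Summit.HodgeConjecture.HodgeConjecture.Cruxes.H413.F0P3cStCharTSUpTrSpecLB

end
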